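import Summits.HubbardSuperconductivity.HubbardSuperconductivity.Theorems.AnisotropyChordTransferFibre3Hole2Quarter

/-!
# Route `AnisotropyChord` / H0 rotor rung: HOLE₂(.75) at `L = 33` — kernel facts, part c (50 of the 152 `D₄`-classes)

KERNEL FACT for the twice-punctured `33 × 33` torus (zero data): the quarter-table interval Birman–Schwinger checker `Hole2.checkRepsQ`
(`…Fibre3Hole2Quarter`) accepts the listed separations at the certified constant `g_33 ≥ ¾ε₁(33)`, by ONE `decide +kernel`
(`maxHeartbeats 400000` pre-budgeted: the quarter Green table alone is ¾L³ interval operations, recomputed in each part).  The parts are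
glued in `…Hole2L33` and turned into `TwoHoleGap 33 (3/4·eps1 33)` by `Hole2.twoHoleGap_of_checkRepsQ_repList` (`…Fibre3Hole2Cover`).
`L = 33` lies just above the FIN range `9 ≤ L ≤ 32` (`…Hole2FinRange`); HOLE₂ per `L` is needed in the analytic regime as well.
Prover seat `hubbard-h0-rotor-p3` g3; helper for stmt-HubbardSuperconductivity-19089 (`--supports`, helper class).
WHAT THIS IS NOT: nothing here proves superconductivity in the Hubbard model (rotor TARGET as worded stays FALSE, g15 verdict);
kernel facts for ONE input (HOLE₂(.75) at one `L`) of ONE conditional reduction (rung 19089). Tree imports only; no sorry, no `native_decide`.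
-/

set_option linter.dupNamespace false
set_option autoImplicit false

namespace Summit.HubbardSuperconductivity.HubbardSuperconductivity.Theorems.AnisotropyChord.Transfer.Fibre3

namespace Hole2

/-- `D₄`-representatives of the nonzero separations of the `33 × 33` torus, part c. [folklore] -/
def reps33c : List (ℕ × ℕ) := [(13, 12), (13, 13), (14, 0), (14, 1), (14, 2), (14, 3), (14, 4), (14, 5), (14, 6), (14, 7), (14, 8), (14, 9), (14, 10), (14, 11), (14, 12), (14, 13), (14, 14), (15, 0), (15, 1), (15, 2), (15, 3), (15, 4), (15, 5), (15, 6), (15, 7), (15, 8), (15, 9), (15, 10), (15, 11), (15, 12), (15, 13), (15, 14), (15, 15), (16, 0), (16, 1), (16, 2), (16, 3), (16, 4), (16, 5), (16, 6), (16, 7), (16, 8), (16, 9), (16, 10), (16, 11), (16, 12), (16, 13), (16, 14), (16, 15), (16, 16)]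

set_option maxHeartbeats 400000 in
/-- kernel fact: part c passes the quarter-table interval Birman–Schwinger test at `g_33 ≥ ¾ε₁(33)`. [folklore] -/
theorem checkRepsQ_33c : checkRepsQ 33 reps33c = true := by
  decide +kernel

end Hole2

end Summit.HubbardSuperconductivity.HubbardSuperconductivity.Theorems.AnisotropyChord.Transfer.Fibre3
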